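import Summits.QuantumFields.YangMills.Theorems.QuantileBitPurityFluxHalfRing
import Summits.QuantumFields.YangMills.Theorems.QuantileBitPuritySectors
import HarnessLib

/-!
# Seam sectors as twisted half-ring pairings: `W_z(H(U₀, U_{q+1}, U_{q+2})) = ∫dx ∫da Ψ_q(x,a) ∫da' K_β(a,a') H(x,a,a') Ψ_q(a', tw_z x)`

Support module (`--supports` stmt-QuantumFields-24093, `QuantileBitPurity.EquatorBandVanishing`; seat ym-dw-p1 g17, LINE g12-B of ideator seat ym-idea-4;
lattice side of the «flux reflection» lever).  The weight of the seam sector `z` (`TT.sectorWeight`, defs `QuantileBitPuritySectorDefs`) on a ring of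
`2q+3` slices (ODD number of bonds) with an insertion depending on slice `0` and on the two slices `q+1, q+2` around the ANTIPODAL BOND is a pairing of two
copies of the half-ring kernel `Ψ_q` (`QuantileBitPurityFluxHalfRing`) through the plain transfer kernel, the second copy read at the TWISTED point:

★ `sectorWeight_eq_halfRing_odd`:
`sectorWeight β (1 + (2q+1)) z (H(U₀, U_{q+1}, U_{q+2})) = ∫dx ∫da Ψ_q(x,a) ∫da' K_β(a,a') H(x,a,a') Ψ_q(a', tw_z x)`
for bounded measurable `H` that is gauge invariant in its last two slots jointly (cut the cycle at slice `0`, peel it with Lit `integral_hetPathWeight_eq_foldr`,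
homogenise the two half rings to `K_β^G`-iterates on gauge-invariant seeds, and read off the kernel of the outer half ring, `integral_transferKernel_iterate_eq`);
and ★ `sectorWeight_eq_halfRing_even`, the ring of `2q+2` slices (EVEN number of bonds) with an insertion at slices `0` and `q+1` (the antipodal SLICE):
`sectorWeight β (1 + 2q) z (H(U₀, U_{q+1})) = ∫dx ∫da Ψ_q(x,a) H(x,a) Ψ_q(a, tw_z x)`.

HONEST FRAMING: fixed-lattice transfer-matrix bookkeeping; nothing about infinite volume, the continuum limit or the Clay gap.  No `sorry`, no new axiom,
no new definition.  References: [cite: MontvayMunster1994, (3.145)]; [cite: tHooft1979]; [cite: SeilerLNP1982, §3].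
-/

set_option autoImplicit false

noncomputable section

open MeasureTheory Filter Topology Real Function
open scoped BigOperators
open Literature.MathematicalPhysics.QuantumLattice
open Literature.MathematicalPhysics.QuantumFieldTheory hiding SU2
open Literature.Analysis.OperatorTheory
open Summit.QuantumFields.YangMills.Theorems

namespace Summit.QuantumFields.YangMills.Theorems.FemtoTransferGap.TT

open Summit.QuantumFields.YangMills.Theorems.FemtoTransferGap
open Summit.QuantumFields.YangMills.Theorems.FemtoTransferGap.TwoLattice.TowerA

variable {L : ℕ} [NeZero L]

/-! ## §1 The seam field integrated out against a slice functional -/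

/-- **The seam field integrated out**: for a bounded measurable functional `F` of the slices alone,
`sectorWeight β n z F = ∫ dU⃗ ∏_{i<n} K_β(U_i,U_{i+1}) · K_β^G(U_n, tw_z U_0) · F(U⃗)`. [cite: MontvayMunster1994, (3.145)] -/
theorem sectorWeight_eq_integral_gaugeKernel_of_slices (β : ℝ) (n : ℕ) (z : Fin 3 → Bool) {F : (Fin (n + 1) → GaugeConfig 3 L SU2) → ℝ}
    (hF : Measurable F) {C : ℝ} (hFb : ∀ Us, |F Us| ≤ C) :
    sectorWeight (L := L) β n z (fun Us _ => F Us) = ∫ Us : Fin (n + 1) → GaugeConfig 3 L SU2,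
      (∏ i : Fin n, transferKernel su2Rep β (Us i.castSucc) (Us i.succ)) * gaugeKernel β (Us (Fin.last n)) (twist3 z (Us 0)) * F Us
      ∂(Measure.pi fun _ : Fin (n + 1) => configMeasure SU2 L) := by
  haveI := isProbabilityMeasure_gaugeMeasure (L := L)
  have hF' : Measurable (uncurry fun (Us : Fin (n + 1) → GaugeConfig 3 L SU2) (_g : Site 3 L → SU2) => F Us) := hF.comp measurable_fst
  have hint := integrable_sectorIntegrand (L := L) β n z hF' (fun Us _ => hFb Us)
  rw [sectorWeight_apply, ← integral_integral_swap hint]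
  refine integral_congr_ae (ae_of_all _ fun Us => ?_)
  dsimp only
  have h : ∀ g : Site 3 L → SU2, (∏ i : Fin n, transferKernel su2Rep β (Us i.castSucc) (Us i.succ)) *
      transferKernel su2Rep β (Us (Fin.last n)) (gaugeTransform g (twist3 z (Us 0))) * F Us =
      ((∏ i : Fin n, transferKernel su2Rep β (Us i.castSucc) (Us i.succ)) * F Us) *
        transferKernel su2Rep β (Us (Fin.last n)) (gaugeTransform g (twist3 z (Us 0))) := fun g => by ring
  simp_rw [h]
  rw [integral_const_mul, gaugeKernel_apply]
  ring

/-! ## §2 Bookkeeping: a product with one special factor; the inner half of the peeled ring -/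

omit [NeZero L] in
/-- A product over `Fin m` of factors equal to `1` off one index. [folklore] -/
theorem prod_ite_val_eq {m k : ℕ} (hk : k < m) (b : Fin m → ℝ) :
    ∏ i : Fin m, (if (i : ℕ) = k then b i else 1) = b ⟨k, hk⟩ := by
  rw [Finset.prod_eq_single ⟨k, hk⟩]
  · simp
  · intro i _ hi
    have : (i : ℕ) ≠ k := fun h => hi (Fin.ext h)
    simp [this]
  · intro h; exact absurd (Finset.mem_univ _) h

/-- The inner half of the peeled ring: `q` bond operators starting with the special bond `p`, applied to the merged last bond `p+q`, give the
special bond operator applied to the `q`-th transfer iterate of the seed (all bonds beyond `p` are plain). [folklore] -/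
theorem foldr_inner_eq {Y : Type*} [MeasurableSpace Y] (ρ : Measure Y) (q p : ℕ) (c : ℕ → Y → Y → ℝ) (K Hk : Y → Y → ℝ) (s0 : Y → ℝ)
    (hc1 : c p = Hk) (hc2 : ∀ i, p < i → c i = K) :
    Fin.foldr q (fun (i : Fin q) (f : Y → ℝ) => fun w => ∫ y, c (i + p) w y * f y ∂ρ) (fun w => ∫ y, c (p + q) w y * s0 y ∂ρ) =
      fun a => ∫ a', Hk a a' * ((fun f : Y → ℝ => fun w => ∫ y, K w y * f y ∂ρ)^[q] s0) a' ∂ρ := by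
  cases q with
  | zero =>
    simp only [Fin.foldr_zero, Function.iterate_zero, id_eq, Nat.add_zero]
    rw [hc1]
  | succ q' =>
    rw [Fin.foldr_succ]
    have hidx : ∀ i : Fin q', ((Fin.succ i : Fin (q' + 1)) : ℕ) + p = (i : ℕ) + (p + 1) := fun i => by
      rw [Fin.val_succ]; omega
    simp only [Fin.val_zero, Nat.zero_add, hidx]
    have hseed : (fun w => ∫ y, c (p + (q' + 1)) w y * s0 y ∂ρ) = fun w => ∫ y, K w y * s0 y ∂ρ := by
      rw [hc2 _ (by omega)]
    rw [hseed, foldr_op_eq_iterate_of_eq (ρ := ρ) c K q' (p + 1) (fun i hi => hc2 _ (by omega)), hc1,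
      ← Function.iterate_succ_apply (fun f : Y → ℝ => fun w => ∫ y, K w y * f y ∂ρ) q' s0]

/-! ## §3 The odd ring -/

set_option maxHeartbeats 800000 in
/-- ★ **The seam sector with an antipodal-bond insertion as a twisted half-ring pairing** (ring of `2q+3` slices, written `1 + (q+1+q) + 1`;
`H` bounded measurable, gauge invariant jointly in its two bond slots; `i₁, i₂` the slices `q+1, q+2`). [cite: MontvayMunster1994, (3.145)] [cite: tHooft1979] -/
theorem sectorWeight_eq_halfRing_odd {β M : ℝ} (hM : ∀ U V : GaugeConfig 3 L SU2, |transferKernel su2Rep β U V| ≤ M) (q : ℕ) (z : Fin 3 → Bool)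
    {H : GaugeConfig 3 L SU2 → GaugeConfig 3 L SU2 → GaugeConfig 3 L SU2 → ℝ}
    (hHm : Measurable fun p : GaugeConfig 3 L SU2 × GaugeConfig 3 L SU2 × GaugeConfig 3 L SU2 => H p.1 p.2.1 p.2.2)
    {CH : ℝ} (hHb : ∀ x a a', |H x a a'| ≤ CH)
    (hHg : ∀ (g : Site 3 L → SU2) (x a a' : GaugeConfig 3 L SU2), H x (gaugeTransform g a) (gaugeTransform g a') = H x a a')
    (i₁ i₂ : Fin (1 + (q + 1 + q) + 1)) (hi₁ : (i₁ : ℕ) = q + 1) (hi₂ : (i₂ : ℕ) = q + 2) :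
    sectorWeight (L := L) β (1 + (q + 1 + q)) z (fun Us _ => H (Us 0) (Us i₁) (Us i₂)) =
      ∫ x, ∫ a, ((fun f : GaugeConfig 3 L SU2 → ℝ => fun U => ∫ V, gaugeKernel β U V * f V ∂configMeasure SU2 L)^[q]
            (fun w => gaugeKernel β w a)) x *
          ∫ a', transferKernel su2Rep β a a' * H x a a' *
            ((fun f : GaugeConfig 3 L SU2 → ℝ => fun U => ∫ V, gaugeKernel β U V * f V ∂configMeasure SU2 L)^[q]
              (fun w => gaugeKernel β w (twist3 z x))) a' ∂configMeasure SU2 L ∂configMeasure SU2 L ∂configMeasure SU2 L := by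
  have hM0 : 0 ≤ M := (abs_nonneg _).trans (hM 1 1)
  have hCH : 0 ≤ CH := (abs_nonneg _).trans (hHb 1 1 1)
  have hK := (PhysL2.stronglyMeasurable_transferKernel (L := L) β).measurable
  have hKG := (stronglyMeasurable_gaugeKernel (L := L) β).measurable
  -- Step 1: the seam field integrated out
  have hpi : ∀ i : Fin (1 + (q + 1 + q) + 1), Measurable fun Us : Fin (1 + (q + 1 + q) + 1) → GaugeConfig 3 L SU2 => Us i :=
    fun i => measurable_pi_apply i
  have hFm : Measurable fun Us : Fin (1 + (q + 1 + q) + 1) → GaugeConfig 3 L SU2 => H (Us 0) (Us i₁) (Us i₂) := by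
    have h := hHm.comp ((hpi 0).prodMk ((hpi i₁).prodMk (hpi i₂))); exact h
  rw [sectorWeight_eq_integral_gaugeKernel_of_slices β (1 + (q + 1 + q)) z hFm (fun Us => hHb _ _ _)]
  -- Step 2: cut the cycle at slice `0`
  have hΦm : Measurable fun Us : Fin (1 + (q + 1 + q) + 1) → GaugeConfig 3 L SU2 =>
      (∏ i : Fin (1 + (q + 1 + q)), transferKernel su2Rep β (Us i.castSucc) (Us i.succ)) *
        gaugeKernel β (Us (Fin.last (1 + (q + 1 + q)))) (twist3 z (Us 0)) * H (Us 0) (Us i₁) (Us i₂) := by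
    refine ((Finset.measurable_prod _ fun i _ => ?_).mul ?_).mul hFm
    · have h := hK.comp ((hpi i.castSucc).prodMk (hpi i.succ)); exact h
    · have h := hKG.comp ((hpi (Fin.last _)).prodMk ((measurable_twist3 z).comp (hpi 0))); exact h
  have hΦb : ∀ Us : Fin (1 + (q + 1 + q) + 1) → GaugeConfig 3 L SU2,
      ‖(∏ i : Fin (1 + (q + 1 + q)), transferKernel su2Rep β (Us i.castSucc) (Us i.succ)) *
        gaugeKernel β (Us (Fin.last (1 + (q + 1 + q)))) (twist3 z (Us 0)) * H (Us 0) (Us i₁) (Us i₂)‖ ≤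
        M ^ (1 + (q + 1 + q)) * M * CH := by
    intro Us
    rw [norm_mul, norm_mul, norm_prod, Real.norm_eq_abs, Real.norm_eq_abs]
    refine mul_le_mul (mul_le_mul ?_ (abs_gaugeKernel_le hM _ _) (abs_nonneg _) (pow_nonneg hM0 _)) (hHb _ _ _) (abs_nonneg _)
      (mul_nonneg (pow_nonneg hM0 _) hM0)
    calc ∏ i : Fin (1 + (q + 1 + q)), ‖transferKernel su2Rep β (Us i.castSucc) (Us i.succ)‖ ≤ ∏ _i : Fin (1 + (q + 1 + q)), M :=
          Finset.prod_le_prod (fun i _ => norm_nonneg _) fun i _ => by rw [Real.norm_eq_abs]; exact hM _ _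
      _ = M ^ (1 + (q + 1 + q)) := by rw [Finset.prod_const, Finset.card_univ, Fintype.card_fin]
  rw [integral_pi_succ_eq_integral_cons (ρ := configMeasure SU2 L) (1 + (q + 1 + q)) hΦm hΦb]
  refine integral_congr_ae (ae_of_all _ fun x => ?_)
  dsimp only
  -- Step 3: the bond kernels of the open path (the antipodal insertion rides on bond `q+1`)
  set κ : ℕ → GaugeConfig 3 L SU2 → GaugeConfig 3 L SU2 → ℝ :=
    fun t u v => transferKernel su2Rep β u v * (if t = q + 1 then H x u v else 1) with hκ
  have hκm : ∀ t, Measurable (uncurry (κ t)) := by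
    intro t
    by_cases ht : t = q + 1
    · simp only [hκ, ht, if_true]
      have h := hHm.comp ((measurable_const (a := x)).prodMk
        ((measurable_fst (α := GaugeConfig 3 L SU2) (β := GaugeConfig 3 L SU2)).prodMk measurable_snd))
      exact hK.mul h
    · simp only [hκ, ht, if_false, mul_one]; exact hK
  have hκb : ∀ t u v, ‖κ t u v‖ ≤ M * max CH 1 := by
    intro t u v; rw [Real.norm_eq_abs]
    by_cases ht : t = q + 1
    · simp only [hκ, ht, if_true, abs_mul]
      exact mul_le_mul (hM u v) ((hHb x u v).trans (le_max_left _ _)) (abs_nonneg _) hM0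
    · simp only [hκ, ht, if_false, mul_one]
      exact (hM u v).trans (le_mul_of_one_le_right hM0 (le_max_right _ _))
  have hq1 : q < 1 + (q + 1 + q) := by clear hi₁ hi₂; omega
  have hq2 : q + 1 < 1 + (q + 1 + q) := by clear hi₁ hi₂; omega
  have hi₁' : i₁ = (⟨q, hq1⟩ : Fin (1 + (q + 1 + q))).succ := Fin.ext (by rw [Fin.val_succ]; omega)
  have hi₂' : i₂ = (⟨q + 1, hq2⟩ : Fin (1 + (q + 1 + q))).succ := Fin.ext (by rw [Fin.val_succ]; omega)
  have hlast : Fin.last (1 + (q + 1 + q)) = (((0 : Fin 1).addNat (q + 1 + q) : Fin (1 + (q + 1 + q)))).succ := Fin.ext (by simp; omega)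
  have hΦcons : ∀ ζ : Fin (1 + (q + 1 + q)) → GaugeConfig 3 L SU2,
      (∏ i : Fin (1 + (q + 1 + q)), transferKernel su2Rep β ((Fin.cons x ζ : Fin (1 + (q + 1 + q) + 1) → GaugeConfig 3 L SU2) i.castSucc)
          ((Fin.cons x ζ : Fin (1 + (q + 1 + q) + 1) → GaugeConfig 3 L SU2) i.succ)) *
        gaugeKernel β ((Fin.cons x ζ : Fin (1 + (q + 1 + q) + 1) → GaugeConfig 3 L SU2) (Fin.last (1 + (q + 1 + q))))
          (twist3 z ((Fin.cons x ζ : Fin (1 + (q + 1 + q) + 1) → GaugeConfig 3 L SU2) 0)) *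
        H ((Fin.cons x ζ : Fin (1 + (q + 1 + q) + 1) → GaugeConfig 3 L SU2) 0) ((Fin.cons x ζ : Fin (1 + (q + 1 + q) + 1) → GaugeConfig 3 L SU2) i₁)
          ((Fin.cons x ζ : Fin (1 + (q + 1 + q) + 1) → GaugeConfig 3 L SU2) i₂) =
      (∏ i : Fin (1 + (q + 1 + q)), κ (i + 0) ((Fin.cons x ζ : Fin (1 + (q + 1 + q) + 1) → GaugeConfig 3 L SU2) (Fin.castSucc i)) (ζ i)) *
        gaugeKernel β (ζ ((0 : Fin 1).addNat (q + 1 + q))) (twist3 z x) := by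
    intro ζ
    rw [hi₁', hi₂', hlast]
    simp only [Fin.cons_succ, Fin.cons_zero, Nat.add_zero]
    have hsplit : ∏ i : Fin (1 + (q + 1 + q)), κ i ((Fin.cons x ζ : Fin (1 + (q + 1 + q) + 1) → GaugeConfig 3 L SU2) (Fin.castSucc i)) (ζ i) =
        (∏ i : Fin (1 + (q + 1 + q)), transferKernel su2Rep β ((Fin.cons x ζ : Fin (1 + (q + 1 + q) + 1) → GaugeConfig 3 L SU2) (Fin.castSucc i)) (ζ i)) *
          ∏ i : Fin (1 + (q + 1 + q)), (if (i : ℕ) = q + 1 then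
            H x ((Fin.cons x ζ : Fin (1 + (q + 1 + q) + 1) → GaugeConfig 3 L SU2) (Fin.castSucc i)) (ζ i) else 1) := by
      rw [← Finset.prod_mul_distrib]
    rw [hsplit, prod_ite_val_eq hq2]
    have hcs : ((⟨q + 1, hq2⟩ : Fin (1 + (q + 1 + q))).castSucc : Fin (1 + (q + 1 + q) + 1)) = (⟨q, hq1⟩ : Fin (1 + (q + 1 + q))).succ :=
      Fin.ext (by simp)
    rw [hcs, Fin.cons_succ]
    ring
  simp_rw [hΦcons]
  -- Step 4: peel the open path (Lit), tail block of one slice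
  have hGm : Measurable fun ζ' : Fin 1 → GaugeConfig 3 L SU2 => gaugeKernel β (ζ' 0) (twist3 z x) := by
    have h := hKG.comp ((measurable_pi_apply (X := fun _ : Fin 1 => GaugeConfig 3 L SU2) 0).prodMk (measurable_const (a := twist3 z x))); exact h
  have hGb : ∀ ζ' : Fin 1 → GaugeConfig 3 L SU2, ‖gaugeKernel β (ζ' 0) (twist3 z x)‖ ≤ M * max CH 1 := fun ζ' => by
    rw [Real.norm_eq_abs]; exact (abs_gaugeKernel_le hM _ _).trans (le_mul_of_one_le_right hM0 (le_max_right _ _))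
  have h4 := integral_hetPathWeight_eq_foldr (ρ := configMeasure SU2 L) hκm hκb 1 hGm hGb (q + 1 + q) 0 x
  simp only [Nat.zero_add] at h4
  rw [h4]
  -- Step 5: the merged last bond
  have hseed : (fun w : GaugeConfig 3 L SU2 => ∫ ζ' : Fin 1 → GaugeConfig 3 L SU2,
      (∏ i : Fin 1, κ (i + (q + 1 + q)) ((Fin.cons w ζ' : Fin (1 + 1) → GaugeConfig 3 L SU2) (Fin.castSucc i)) (ζ' i)) *
        gaugeKernel β (ζ' 0) (twist3 z x) ∂(Measure.pi fun _ => configMeasure SU2 L)) =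
      fun w => ∫ y, κ (q + 1 + q) w y * gaugeKernel β y (twist3 z x) ∂configMeasure SU2 L := by
    funext w
    have hfun : (fun ζ' : Fin 1 → GaugeConfig 3 L SU2 =>
        (∏ i : Fin 1, κ (i + (q + 1 + q)) ((Fin.cons w ζ' : Fin (1 + 1) → GaugeConfig 3 L SU2) (Fin.castSucc i)) (ζ' i)) *
          gaugeKernel β (ζ' 0) (twist3 z x)) = fun ζ' => κ (q + 1 + q) w (ζ' 0) * gaugeKernel β (ζ' 0) (twist3 z x) := by
      funext ζ'; simp
    rw [hfun, ← (measurePreserving_funUnique (configMeasure SU2 L) (Fin 1)).integral_comp (MeasurableEquiv.funUnique (Fin 1) (GaugeConfig 3 L SU2)).measurableEmbedding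
      (fun y : GaugeConfig 3 L SU2 => κ (q + 1 + q) w y * gaugeKernel β y (twist3 z x))]
    rfl
  rw [hseed]
  -- Step 6: split the nested operators: outer `q+1` plain bonds, inner = antipodal bond after `q` plain bonds
  rw [foldr_add_eq_foldr_foldr (fun (i : ℕ) (f : GaugeConfig 3 L SU2 → ℝ) => fun w => ∫ y, κ (i + 0) w y * f y ∂configMeasure SU2 L) (q + 1) q]
  have hc_out : ∀ i, i < q + 1 → κ (i + 0) = transferKernel su2Rep β := fun i hi => by
    funext u v; simp [hκ, show i ≠ q + 1 by omega]
  rw [foldr_op_eq_iterate_of_eq (ρ := configMeasure SU2 L) κ (transferKernel su2Rep β) (q + 1) 0 hc_out]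
  have hidx0 : ∀ i : Fin q, (i : ℕ) + (q + 1) + 0 = i + (q + 1) := fun i => by omega
  simp only [hidx0]
  rw [foldr_inner_eq (configMeasure SU2 L) q (q + 1) κ (transferKernel su2Rep β) (fun u v => transferKernel su2Rep β u v * H x u v)
    (fun y => gaugeKernel β y (twist3 z x)) (by funext u v; simp [hκ]) (fun i hi => by funext u v; simp [hκ, show i ≠ q + 1 by omega])]
  -- Step 7: homogenise the inner half ring and read off the kernel of the outer one
  obtain ⟨hsm, hsb, hsg⟩ := seed_section_props (L := L) hM (twist3 z x)
  rw [← (iterate_gaugeKernelOp_eq (L := L) β hsm hsb hsg q).1]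
  -- the antipodal bond operator applied to `Ψ_q(·, tw x)` is bounded, measurable and gauge invariant
  obtain ⟨hΨm, hΨg⟩ := iterate_section_measurable_gaugeTransform_left (L := L) hM q (twist3 z x)
  have hΨb := fun a => (iterate_section_nonneg_le (L := L) hM q (twist3 z x) a)
  set h : GaugeConfig 3 L SU2 → ℝ := ((fun f : GaugeConfig 3 L SU2 → ℝ => fun U => ∫ V, gaugeKernel β U V * f V ∂configMeasure SU2 L)^[q])
    (fun w => gaugeKernel β w (twist3 z x)) with hh
  have hFm2 : Measurable fun a : GaugeConfig 3 L SU2 => ∫ a', transferKernel su2Rep β a a' * H x a a' * h a' ∂configMeasure SU2 L := by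
    have h1 : Measurable fun p : GaugeConfig 3 L SU2 × GaugeConfig 3 L SU2 => transferKernel su2Rep β p.1 p.2 * H x p.1 p.2 * h p.2 := by
      have hH2 := hHm.comp ((measurable_const (a := x)).prodMk
        ((measurable_fst (α := GaugeConfig 3 L SU2) (β := GaugeConfig 3 L SU2)).prodMk measurable_snd))
      exact (hK.mul hH2).mul (hΨm.comp measurable_snd)
    exact (h1.stronglyMeasurable.integral_prod_right' (ν := configMeasure SU2 L)).measurable
  have hFb2 : ∀ a, |∫ a', transferKernel su2Rep β a a' * H x a a' * h a' ∂configMeasure SU2 L| ≤ M * CH * M ^ (q + 1) := by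
    intro a
    have hb := norm_integral_le_of_norm_le_const (μ := configMeasure SU2 L) (f := fun a' => transferKernel su2Rep β a a' * H x a a' * h a')
      (C := M * CH * M ^ (q + 1)) (ae_of_all _ fun a' => by
        rw [Real.norm_eq_abs, abs_mul, abs_mul, abs_of_nonneg (hΨb a').1]
        exact mul_le_mul (mul_le_mul (hM _ _) (hHb _ _ _) (abs_nonneg _) hM0) (hΨb a').2 (hΨb a').1 (mul_nonneg hM0 hCH))
    rw [probReal_univ, mul_one, Real.norm_eq_abs] at hb
    exact hb
  have hFg2 : ∀ (g : Site 3 L → SU2) (a : GaugeConfig 3 L SU2),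
      ∫ a', transferKernel su2Rep β (gaugeTransform g a) a' * H x (gaugeTransform g a) a' * h a' ∂configMeasure SU2 L =
        ∫ a', transferKernel su2Rep β a a' * H x a a' * h a' ∂configMeasure SU2 L := by
    intro g a; have hm : Measurable fun a' => transferKernel su2Rep β (gaugeTransform g a) a' * H x (gaugeTransform g a) a' * h a' := by
      have hH2 := hHm.comp ((measurable_const (a := x)).prodMk ((measurable_const (a := gaugeTransform g a)).prodMk
        (measurable_id (α := GaugeConfig 3 L SU2))))
      exact ((measurable_transferKernel_right β _).mul hH2).mul hΨm
    rw [← integral_comp_eq_of_measurePreserving (measurePreserving_gaugeTransform_configMeasure g) hm]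
    refine integral_congr_ae (ae_of_all _ fun a' => ?_)
    dsimp only
    rw [transferKernel_gaugeTransform, hHg, hΨg]
  rw [integral_transferKernel_iterate_eq (L := L) hM q hFm2 hFb2 hFg2 x]

/-! ## §4 The even ring -/

set_option maxHeartbeats 800000 in
/-- ★ **The seam sector with an antipodal-slice insertion as a twisted half-ring pairing** (ring of `2q+2` slices, written `1 + (q+q) + 1`;
`H` bounded measurable, gauge invariant in its slice slot; `i₁` the slice `q+1`). [cite: MontvayMunster1994, (3.145)] [cite: tHooft1979] -/
theorem sectorWeight_eq_halfRing_even {β M : ℝ} (hM : ∀ U V : GaugeConfig 3 L SU2, |transferKernel su2Rep β U V| ≤ M) (q : ℕ) (z : Fin 3 → Bool)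
    {H : GaugeConfig 3 L SU2 → GaugeConfig 3 L SU2 → ℝ} (hHm : Measurable (uncurry H)) {CH : ℝ} (hHb : ∀ x a, |H x a| ≤ CH)
    (hHg : ∀ (g : Site 3 L → SU2) (x a : GaugeConfig 3 L SU2), H x (gaugeTransform g a) = H x a)
    (i₁ : Fin (1 + (q + q) + 1)) (hi₁ : (i₁ : ℕ) = q + 1) :
    sectorWeight (L := L) β (1 + (q + q)) z (fun Us _ => H (Us 0) (Us i₁)) =
      ∫ x, ∫ a, ((fun f : GaugeConfig 3 L SU2 → ℝ => fun U => ∫ V, gaugeKernel β U V * f V ∂configMeasure SU2 L)^[q]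
            (fun w => gaugeKernel β w a)) x * H x a *
          ((fun f : GaugeConfig 3 L SU2 → ℝ => fun U => ∫ V, gaugeKernel β U V * f V ∂configMeasure SU2 L)^[q]
            (fun w => gaugeKernel β w (twist3 z x))) a ∂configMeasure SU2 L ∂configMeasure SU2 L := by
  have hM0 : 0 ≤ M := (abs_nonneg _).trans (hM 1 1)
  have hCH : 0 ≤ CH := (abs_nonneg _).trans (hHb 1 1)
  have hK := (PhysL2.stronglyMeasurable_transferKernel (L := L) β).measurable
  have hKG := (stronglyMeasurable_gaugeKernel (L := L) β).measurable
  -- Step 1: the seam field integrated out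
  have hpi : ∀ i : Fin (1 + (q + q) + 1), Measurable fun Us : Fin (1 + (q + q) + 1) → GaugeConfig 3 L SU2 => Us i :=
    fun i => measurable_pi_apply i
  have hFm : Measurable fun Us : Fin (1 + (q + q) + 1) → GaugeConfig 3 L SU2 => H (Us 0) (Us i₁) := by
    have h := hHm.comp ((hpi 0).prodMk (hpi i₁)); exact h
  rw [sectorWeight_eq_integral_gaugeKernel_of_slices β (1 + (q + q)) z hFm (fun Us => hHb _ _)]
  -- Step 2: cut the cycle at slice `0`
  have hΦm : Measurable fun Us : Fin (1 + (q + q) + 1) → GaugeConfig 3 L SU2 =>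
      (∏ i : Fin (1 + (q + q)), transferKernel su2Rep β (Us i.castSucc) (Us i.succ)) *
        gaugeKernel β (Us (Fin.last (1 + (q + q)))) (twist3 z (Us 0)) * H (Us 0) (Us i₁) := by
    refine ((Finset.measurable_prod _ fun i _ => ?_).mul ?_).mul hFm
    · have h := hK.comp ((hpi i.castSucc).prodMk (hpi i.succ)); exact h
    · have h := hKG.comp ((hpi (Fin.last _)).prodMk ((measurable_twist3 z).comp (hpi 0))); exact h
  have hΦb : ∀ Us : Fin (1 + (q + q) + 1) → GaugeConfig 3 L SU2,
      ‖(∏ i : Fin (1 + (q + q)), transferKernel su2Rep β (Us i.castSucc) (Us i.succ)) *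
        gaugeKernel β (Us (Fin.last (1 + (q + q)))) (twist3 z (Us 0)) * H (Us 0) (Us i₁)‖ ≤ M ^ (1 + (q + q)) * M * CH := by
    intro Us
    rw [norm_mul, norm_mul, norm_prod, Real.norm_eq_abs, Real.norm_eq_abs]
    refine mul_le_mul (mul_le_mul ?_ (abs_gaugeKernel_le hM _ _) (abs_nonneg _) (pow_nonneg hM0 _)) (hHb _ _) (abs_nonneg _)
      (mul_nonneg (pow_nonneg hM0 _) hM0)
    calc ∏ i : Fin (1 + (q + q)), ‖transferKernel su2Rep β (Us i.castSucc) (Us i.succ)‖ ≤ ∏ _i : Fin (1 + (q + q)), M :=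
          Finset.prod_le_prod (fun i _ => norm_nonneg _) fun i _ => by rw [Real.norm_eq_abs]; exact hM _ _
      _ = M ^ (1 + (q + q)) := by rw [Finset.prod_const, Finset.card_univ, Fintype.card_fin]
  rw [integral_pi_succ_eq_integral_cons (ρ := configMeasure SU2 L) (1 + (q + q)) hΦm hΦb]
  refine integral_congr_ae (ae_of_all _ fun x => ?_)
  dsimp only
  -- Step 3: the bond kernels of the open path (the slice insertion rides on the target of bond `q`)
  set κ : ℕ → GaugeConfig 3 L SU2 → GaugeConfig 3 L SU2 → ℝ :=
    fun t u v => transferKernel su2Rep β u v * (if t = q then H x v else 1) with hκ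
  have hκm : ∀ t, Measurable (uncurry (κ t)) := by
    intro t
    by_cases ht : t = q
    · simp only [hκ, ht, if_true]
      have h : Measurable fun p : GaugeConfig 3 L SU2 × GaugeConfig 3 L SU2 => (x, p.2) := (measurable_const (a := x)).prodMk measurable_snd
      exact hK.mul (hHm.comp h)
    · simp only [hκ, ht, if_false, mul_one]; exact hK
  have hκb : ∀ t u v, ‖κ t u v‖ ≤ M * max CH 1 := by
    intro t u v; rw [Real.norm_eq_abs]
    by_cases ht : t = q
    · simp only [hκ, ht, if_true, abs_mul]
      exact mul_le_mul (hM u v) ((hHb x v).trans (le_max_left _ _)) (abs_nonneg _) hM0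
    · simp only [hκ, ht, if_false, mul_one]
      exact (hM u v).trans (le_mul_of_one_le_right hM0 (le_max_right _ _))
  have hq1 : q < 1 + (q + q) := by clear hi₁; omega
  have hi₁' : i₁ = (⟨q, hq1⟩ : Fin (1 + (q + q))).succ := Fin.ext (by rw [Fin.val_succ]; omega)
  have hlast : Fin.last (1 + (q + q)) = (((0 : Fin 1).addNat (q + q) : Fin (1 + (q + q)))).succ := Fin.ext (by simp; omega)
  have hΦcons : ∀ ζ : Fin (1 + (q + q)) → GaugeConfig 3 L SU2,
      (∏ i : Fin (1 + (q + q)), transferKernel su2Rep β ((Fin.cons x ζ : Fin (1 + (q + q) + 1) → GaugeConfig 3 L SU2) i.castSucc)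
          ((Fin.cons x ζ : Fin (1 + (q + q) + 1) → GaugeConfig 3 L SU2) i.succ)) *
        gaugeKernel β ((Fin.cons x ζ : Fin (1 + (q + q) + 1) → GaugeConfig 3 L SU2) (Fin.last (1 + (q + q))))
          (twist3 z ((Fin.cons x ζ : Fin (1 + (q + q) + 1) → GaugeConfig 3 L SU2) 0)) *
        H ((Fin.cons x ζ : Fin (1 + (q + q) + 1) → GaugeConfig 3 L SU2) 0) ((Fin.cons x ζ : Fin (1 + (q + q) + 1) → GaugeConfig 3 L SU2) i₁) =
      (∏ i : Fin (1 + (q + q)), κ (i + 0) ((Fin.cons x ζ : Fin (1 + (q + q) + 1) → GaugeConfig 3 L SU2) (Fin.castSucc i)) (ζ i)) *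
        gaugeKernel β (ζ ((0 : Fin 1).addNat (q + q))) (twist3 z x) := by
    intro ζ
    rw [hi₁', hlast]
    simp only [Fin.cons_succ, Fin.cons_zero, Nat.add_zero]
    have hsplit : ∏ i : Fin (1 + (q + q)), κ i ((Fin.cons x ζ : Fin (1 + (q + q) + 1) → GaugeConfig 3 L SU2) (Fin.castSucc i)) (ζ i) =
        (∏ i : Fin (1 + (q + q)), transferKernel su2Rep β ((Fin.cons x ζ : Fin (1 + (q + q) + 1) → GaugeConfig 3 L SU2) (Fin.castSucc i)) (ζ i)) *
          ∏ i : Fin (1 + (q + q)), (if (i : ℕ) = q then H x (ζ i) else 1) := by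
      rw [← Finset.prod_mul_distrib]
    rw [hsplit, prod_ite_val_eq hq1]
    ring
  simp_rw [hΦcons]
  -- Step 4: peel the open path (Lit), tail block of one slice
  have hGm : Measurable fun ζ' : Fin 1 → GaugeConfig 3 L SU2 => gaugeKernel β (ζ' 0) (twist3 z x) := by
    have h := hKG.comp ((measurable_pi_apply (X := fun _ : Fin 1 => GaugeConfig 3 L SU2) 0).prodMk (measurable_const (a := twist3 z x))); exact h
  have hGb : ∀ ζ' : Fin 1 → GaugeConfig 3 L SU2, ‖gaugeKernel β (ζ' 0) (twist3 z x)‖ ≤ M * max CH 1 := fun ζ' => by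
    rw [Real.norm_eq_abs]; exact (abs_gaugeKernel_le hM _ _).trans (le_mul_of_one_le_right hM0 (le_max_right _ _))
  have h4 := integral_hetPathWeight_eq_foldr (ρ := configMeasure SU2 L) hκm hκb 1 hGm hGb (q + q) 0 x
  simp only [Nat.zero_add] at h4
  rw [h4]
  -- Step 5: the merged last bond
  have hseed : (fun w : GaugeConfig 3 L SU2 => ∫ ζ' : Fin 1 → GaugeConfig 3 L SU2,
      (∏ i : Fin 1, κ (i + (q + q)) ((Fin.cons w ζ' : Fin (1 + 1) → GaugeConfig 3 L SU2) (Fin.castSucc i)) (ζ' i)) *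
        gaugeKernel β (ζ' 0) (twist3 z x) ∂(Measure.pi fun _ => configMeasure SU2 L)) =
      fun w => ∫ y, κ (q + q) w y * gaugeKernel β y (twist3 z x) ∂configMeasure SU2 L := by
    funext w
    have hfun : (fun ζ' : Fin 1 → GaugeConfig 3 L SU2 =>
        (∏ i : Fin 1, κ (i + (q + q)) ((Fin.cons w ζ' : Fin (1 + 1) → GaugeConfig 3 L SU2) (Fin.castSucc i)) (ζ' i)) *
          gaugeKernel β (ζ' 0) (twist3 z x)) = fun ζ' => κ (q + q) w (ζ' 0) * gaugeKernel β (ζ' 0) (twist3 z x) := by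
      funext ζ'; simp
    rw [hfun, ← (measurePreserving_funUnique (configMeasure SU2 L) (Fin 1)).integral_comp (MeasurableEquiv.funUnique (Fin 1) (GaugeConfig 3 L SU2)).measurableEmbedding
      (fun y : GaugeConfig 3 L SU2 => κ (q + q) w y * gaugeKernel β y (twist3 z x))]
    rfl
  rw [hseed]
  -- Step 6: split the nested operators: outer `q` plain bonds, inner = insertion bond after `q` plain bonds
  rw [foldr_add_eq_foldr_foldr (fun (i : ℕ) (f : GaugeConfig 3 L SU2 → ℝ) => fun w => ∫ y, κ (i + 0) w y * f y ∂configMeasure SU2 L) q q]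
  have hc_out : ∀ i, i < q → κ (i + 0) = transferKernel su2Rep β := fun i hi => by
    funext u v; simp [hκ, show i ≠ q by omega]
  rw [foldr_op_eq_iterate_of_eq (ρ := configMeasure SU2 L) κ (transferKernel su2Rep β) q 0 hc_out]
  have hidx0 : ∀ i : Fin q, (i : ℕ) + q + 0 = i + q := fun i => by omega
  simp only [hidx0]
  rw [foldr_inner_eq (configMeasure SU2 L) q q κ (transferKernel su2Rep β) (fun u v => transferKernel su2Rep β u v * H x v)
    (fun y => gaugeKernel β y (twist3 z x)) (by funext u v; simp [hκ]) (fun i hi => by funext u v; simp [hκ, show i ≠ q by omega])]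
  -- Step 7: the inner function is one more transfer step applied to `H(x,·) · (T^q seed)`
  have e7 : (fun a : GaugeConfig 3 L SU2 => ∫ a', transferKernel su2Rep β a a' * H x a' *
      ((fun f : GaugeConfig 3 L SU2 → ℝ => fun w => ∫ y, transferKernel su2Rep β w y * f y ∂configMeasure SU2 L)^[q])
        (fun y => gaugeKernel β y (twist3 z x)) a' ∂configMeasure SU2 L) =
      (fun f : GaugeConfig 3 L SU2 → ℝ => fun w => ∫ y, transferKernel su2Rep β w y * f y ∂configMeasure SU2 L)
        (fun a' => H x a' * ((fun f : GaugeConfig 3 L SU2 → ℝ => fun w => ∫ y, transferKernel su2Rep β w y * f y ∂configMeasure SU2 L)^[q])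
          (fun y => gaugeKernel β y (twist3 z x)) a') := by
    funext a
    exact integral_congr_ae (ae_of_all _ fun a' => by ring)
  rw [e7, ← Function.iterate_succ_apply]
  -- Step 8: homogenise and read off the kernel of the outer half ring
  obtain ⟨hsm, hsb, hsg⟩ := seed_section_props (L := L) hM (twist3 z x)
  rw [← (iterate_gaugeKernelOp_eq (L := L) β hsm hsb hsg q).1]
  obtain ⟨hΨm, hΨg⟩ := iterate_section_measurable_gaugeTransform_left (L := L) hM q (twist3 z x)
  have hΨb := fun a => (iterate_section_nonneg_le (L := L) hM q (twist3 z x) a)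
  set h : GaugeConfig 3 L SU2 → ℝ := ((fun f : GaugeConfig 3 L SU2 → ℝ => fun U => ∫ V, gaugeKernel β U V * f V ∂configMeasure SU2 L)^[q])
    (fun w => gaugeKernel β w (twist3 z x)) with hh
  have hFm2 : Measurable fun a' : GaugeConfig 3 L SU2 => H x a' * h a' := (hHm.comp ((measurable_const (a := x)).prodMk measurable_id)).mul hΨm
  have hFb2 : ∀ a', |H x a' * h a'| ≤ CH * M ^ (q + 1) := fun a' => by
    rw [abs_mul, abs_of_nonneg (hΨb a').1]; exact mul_le_mul (hHb x a') (hΨb a').2 (hΨb a').1 hCH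
  have hFg2 : ∀ (g : Site 3 L → SU2) (a' : GaugeConfig 3 L SU2), H x (gaugeTransform g a') * h (gaugeTransform g a') = H x a' * h a' :=
    fun g a' => by rw [hHg, hΨg]
  rw [integral_transferKernel_iterate_eq (L := L) hM q hFm2 hFb2 hFg2 x]
  exact integral_congr_ae (ae_of_all _ fun a => by ring)

end Summit.QuantumFields.YangMills.Theorems.FemtoTransferGap.TT

end
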